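import Summits.Ventures.Crystal3D.Theorems.StickyWulffConstantCoaxialWallLawUnifAssemblyWith
import Summits.Ventures.Crystal3D.Theorems.StickyWulffConstantCoaxialWallLawReachCoreOfRowsAWith
import HarnessLib

/-!
# F-U from the two census rows (A) at explicit constants: `∃ C, CoaxialTwoSlabAdhesionUnifAt C 10`

HONEST FRAMING. Venture `Summits/Ventures/Crystal3D` (cell `crystal3d-full`), helper `--supports` the crux
`CoaxialWallLaw` (stmt-Ventures-19481, REGISTERED line `WallLedgerF`) and lane T's stub `stub_coaxialUnif :
∃ C, CoaxialUnifAt C 10` (TexShadow v6.20).  Rung credit only — two-line composition, census-free, standard axioms; F-C1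
not moved; `KissingGap δ`, `KissingClassification δ`, E1 (`ExactOnly` / `P5Exhaustion`), `StarPairFar` and the two census
rows (A) stay BY NAME.  cf-p1 DECISION (lxvii): the ROW cone's interface `coaxialTwoSlabAdhesionOnWith_reach_of_twoRowsA`
(19481-p1, `…ReachCoreOfRowsAWith`: the WHOLE reach core R1 ∪ R2 ∪ R3 at one constant from the two rows) fed into the
reach-cone assembly `coaxialTwoSlabAdhesionUnifAt_ten_of_reachWith` (wulff-p2, `…UnifAssemblyWith`):

* **`coaxialTwoSlabAdhesionUnifAt_ten_of_twoRowsA`** : `KissingGap δ → KissingClassification δ → 0 < s_F ≤ 2√6 →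
  EndRowTwinHalfTurnA ver s_F → EndRowTransA ver s_F → s₀ ∈ fccSlots → ExactOnly 0 (star s₀) → StarPairFar →
  ∃ C, CoaxialTwoSlabAdhesionUnifAt C 10`;
* `coaxialTwoSlabAdhesionUnifAt_ten_of_twoRowsA_p5` — E1 as `P5Exhaustion`.
So F-U has NO residual input beyond those of `coaxialWallLaw_of_twoRowsA` (certified / 𝒰_cx on-site forms:
`…CoaxialWallLawUnifAtCapstoneCx`).  WHAT THIS IS NOT: none of the named inputs is proved here; F-C1 not moved.
-/

noncomputable section

namespace Summit.Ventures.Crystal3D.Theorems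

open Summit.Ventures.Crystal3D Finset
open scoped InnerProductSpace

section Rows

variable (ver : WordVersion) {δ : ℝ} (hg : KissingGap δ) (hc : KissingClassification δ)
variable {sF : ℝ} (hsF : 0 < sF) (hsF' : sF ≤ 2 * Real.sqrt 6)
include hg hc hsF hsF'

open scoped Classical in
/-- **F-U FROM THE TWO CENSUS ROWS (A)**, the kissing facts, E1 data and `StarPairFar`:
`∃ C, CoaxialTwoSlabAdhesionUnifAt C 10`. -/
theorem coaxialTwoSlabAdhesionUnifAt_ten_of_twoRowsA (hrowW : EndRowTwinHalfTurnA ver sF) (hrowT : EndRowTransA ver sF)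
    {s₀ : EuclideanSpace ℝ (Fin 3)} (hs₀ : s₀ ∈ fccSlots)
    (hcert : ExactOnly 0 (fccSlots.filter fun w => 0 < ⟪w, s₀⟫_ℝ)) (hSP : StarPairFar) :
    ∃ C : ℝ, CoaxialTwoSlabAdhesionUnifAt C 10 := by
  obtain ⟨K, hK⟩ := coaxialTwoSlabAdhesionOnWith_reach_of_twoRowsA ver hg hc hsF hsF' hrowW hrowT
  exact coaxialTwoSlabAdhesionUnifAt_ten_of_reachWith hs₀ hcert hSP hK

/-- The same with E1 as `P5Exhaustion`. -/
theorem coaxialTwoSlabAdhesionUnifAt_ten_of_twoRowsA_p5 (hrowW : EndRowTwinHalfTurnA ver sF)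
    (hrowT : EndRowTransA ver sF) (hE1 : P5Exhaustion) (hSP : StarPairFar) :
    ∃ C : ℝ, CoaxialTwoSlabAdhesionUnifAt C 10 := by
  obtain ⟨K, hK⟩ := coaxialTwoSlabAdhesionOnWith_reach_of_twoRowsA ver hg hc hsF hsF' hrowW hrowT
  exact coaxialTwoSlabAdhesionUnifAt_ten_of_reachWith_p5 hE1 hSP hK

end Rows

end Summit.Ventures.Crystal3D.Theorems

end
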